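import Mathlib
import Summits.SmoothPoincare4.SmoothPoincare4.Theorems.SoloInformedPairGroupNotFree
import Summits.SmoothPoincare4.SmoothPoincare4.Theorems.SoloInformedPairGroupCollapse

/-!
# The link group of the banked pair `P*` is free on its meridians (solo-informed, session s55)

Setting and notation as in `SoloInformedPairGroupNotFree` (HKM24 = arXiv:2402.11706, Q1.4; banked statement
paper/doors-for-M0.md §2, work/s48/sequential-doors.md; CLAIMS C604/C613): `Γ̃ = ⟨a, b ∣ a³ = (ab)² = b⁷⟩`,
`g_j = b^j g₀ b^{-j}`, `g₀ = ab⁻³`, and the two-level pair group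

  `G(φ; g, g') = ⟨ a, b, x₁, x₂ ∣ a³ = (ab)² = b⁷, (x₂x₁) w (x₂x₁)⁻¹ = φwφ⁻¹ (w = a, b), [x₁, g] = 1, [x₂, x₁g'x₁⁻¹] = 1 ⟩`

(`SoloInformedPairGroup φ g g'`, the presented group of `SoloInformedPGen.pairRels`).  The banked pair `P*` of smoothly
unknotted tori in `X(b) = (S⁴, τ⁷T(2,3))` has classes `{g₀, g₅}` (C613); its two level-orders give `G(b; g₀, g₅)` and
`G(b; g₅, g₀)`.  The pair table C604 recorded both as "F" (GAP).  This file makes that a KERNEL fact and draws the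
conclusion inside Lean:

* `SoloInformed_pair_uComm`, `SoloInformed_pair_uTrick` (the `u`-trick, any group): with `u = b⁻¹x₂x₁` the conjugation
  relations say `[u, a] = [u, b] = 1`, and then `[x₂, x₁g'x₁⁻¹] = 1 ⟺ x₁ g' x₁⁻¹ = b g' b⁻¹` — so `G(b; g, g')` is the
  HNN extension `⟨H, u ∣ [u, Γ̄] = 1⟩` of the one-meridian group `H(b; g, g')` of `SoloInformedPairGroupCollapse`
  (this identifies the GAP model of C604 with the van Kampen presentation of C613(a));
* `SoloInformed_pairG_collapse_05`, `SoloInformed_pairG_collapse_50`: in ANY group, the relations of `G(b; g₀, g₅)`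
  resp. `G(b; g₅, g₀)` force `a = b = 1` (transport to the certificates `SoloInformed_pairH_collapse_05/50` along the
  inner automorphisms `a ↦ b⁻¹ab` resp. `a ↦ b⁻³ab³`, using that `b⁷ = a³` is central);
* `SoloInformedPairGroup.isFreeGroup_of_collapse`, `mulEquivFree`: if the page generators die in `G(φ; g, g')` (and
  `g, g'` are page words) then `G(φ; g, g') ≃* F(x₁, x₂) = FreeGroup Bool`, the retraction killing `a, b` and the
  meridian map being mutually inverse;
* `SoloInformedPairPstar.isFreeGroup_05/50`, `mulEquivFree_05/50`: HENCE the presented groups `G(b; g₀, g₅)` and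
  `G(b; g₅, g₀)` are free of rank two on the level meridians — the positive half of the dichotomy whose negative half
  (`G(b; g₀, g₃)`, `G(a; b, aba⁻¹)` not free) is `SoloInformedPairGroupNotFree`.

Nothing topological is asserted in Lean: that `G(b; g₀, g₅)` is `π₁` of the complement of `P*` is the prose dictionary
C613(a); "free link group" is necessary, not sufficient, for `P*` to be split (banked statement §2: `𝔐₀ ≅ S⁴ ⇐ P* split`).
-/

namespace Summit.SmoothPoincare4.SmoothPoincare4.Theorems

/-! ### 1. The `u`-trick and the collapse of the two-meridian relations (any group) -/

section universal
variable {K : Type*} [Group K] {a b x₁ x₂ : K}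

/-- If `x₂x₁` acts on `a, b` as conjugation by `b`, then `u = b⁻¹x₂x₁` commutes with `a` and with `b`. -/
theorem SoloInformed_pair_uComm (hca : x₂ * x₁ * a = b * a * b⁻¹ * (x₂ * x₁)) (hcb : x₂ * x₁ * b = b * (x₂ * x₁)) :
    Commute (b⁻¹ * (x₂ * x₁)) a ∧ Commute (b⁻¹ * (x₂ * x₁)) b := by
  constructor
  · show b⁻¹ * (x₂ * x₁) * a = a * (b⁻¹ * (x₂ * x₁))
    calc b⁻¹ * (x₂ * x₁) * a = b⁻¹ * (x₂ * x₁ * a) := by simp [mul_assoc]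
    _ = b⁻¹ * (b * a * b⁻¹ * (x₂ * x₁)) := by rw [hca]
    _ = a * (b⁻¹ * (x₂ * x₁)) := by simp [mul_assoc]
  · show b⁻¹ * (x₂ * x₁) * b = b * (b⁻¹ * (x₂ * x₁))
    calc b⁻¹ * (x₂ * x₁) * b = b⁻¹ * (x₂ * x₁ * b) := by simp [mul_assoc]
    _ = b⁻¹ * (b * (x₂ * x₁)) := by rw [hcb]
    _ = b * (b⁻¹ * (x₂ * x₁)) := by simp

/-- The `u`-trick: for `g'` commuting with `u = b⁻¹x₂x₁`, the relation `[x₂, x₁ g' x₁⁻¹] = 1` says `x₁ g' x₁⁻¹ = b g' b⁻¹`. -/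
theorem SoloInformed_pair_uTrick {g' : K} (hg : Commute (b⁻¹ * (x₂ * x₁)) g')
    (hx2 : x₂ * (x₁ * g' * x₁⁻¹) = x₁ * g' * x₁⁻¹ * x₂) : x₁ * g' = b * g' * b⁻¹ * x₁ := by
  obtain ⟨u, hu⟩ : ∃ u, u = b⁻¹ * (x₂ * x₁) := ⟨_, rfl⟩
  rw [← hu] at hg
  have e : x₂ = b * u * x₁⁻¹ := by rw [hu]; simp [mul_assoc]
  rw [e] at hx2
  have e2 : b * u * x₁⁻¹ * (x₁ * g' * x₁⁻¹) = b * (u * g') * x₁⁻¹ := by simp [mul_assoc]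
  rw [e2, hg.eq] at hx2
  symm
  calc b * g' * b⁻¹ * x₁ = (b * (g' * u) * x₁⁻¹) * (x₁ * u⁻¹ * b⁻¹ * x₁) := by simp [mul_assoc]
  _ = (x₁ * g' * x₁⁻¹ * (b * u * x₁⁻¹)) * (x₁ * u⁻¹ * b⁻¹ * x₁) := by rw [hx2]
  _ = x₁ * g' := by simp [mul_assoc]

/-- `g₅ = b⁵g₀b⁻⁵` equals `g₋₂ = b⁻²g₀b²` once `b⁷ = a³` (which is then central). -/
theorem SoloInformed_pair_g5_reduce (hz : b * b * b * b * b * b * b = a * a * a) :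
    b * b * b * b * b * (a * b⁻¹ * b⁻¹ * b⁻¹) * (b⁻¹ * b⁻¹ * b⁻¹ * b⁻¹ * b⁻¹) = b⁻¹ * b⁻¹ * a * b⁻¹ := by
  calc _ = b⁻¹ * b⁻¹ * (b * b * b * b * b * b * b) * a * (b * b * b * b * b * b * b)⁻¹ * b⁻¹ := by simp [mul_assoc]
  _ = b⁻¹ * b⁻¹ * (a * a * a) * a * (a * a * a)⁻¹ * b⁻¹ := by rw [hz]
  _ = _ := by simp [mul_assoc]

/-- LEVEL ORDER `(g₀, g₅)`: in any group the relations of `G(b; g₀, g₅)` force `a = b = 1`. -/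
theorem SoloInformed_pairG_collapse_05 (h0 : a * a * a = a * b * a * b) (h2 : b * b * b * b * b * b * b = a * b * a * b)
    (hca : x₂ * x₁ * a = b * a * b⁻¹ * (x₂ * x₁)) (hcb : x₂ * x₁ * b = b * (x₂ * x₁))
    (hx1 : x₁ * (a * b⁻¹ * b⁻¹ * b⁻¹) = a * b⁻¹ * b⁻¹ * b⁻¹ * x₁)
    (hx2 : x₂ * (x₁ * (b * b * b * b * b * (a * b⁻¹ * b⁻¹ * b⁻¹) * (b⁻¹ * b⁻¹ * b⁻¹ * b⁻¹ * b⁻¹)) * x₁⁻¹)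
      = x₁ * (b * b * b * b * b * (a * b⁻¹ * b⁻¹ * b⁻¹) * (b⁻¹ * b⁻¹ * b⁻¹ * b⁻¹ * b⁻¹)) * x₁⁻¹ * x₂) :
    a = 1 ∧ b = 1 := by
  obtain ⟨ca, cb⟩ := SoloInformed_pair_uComm hca hcb
  have cB : Commute (b⁻¹ * (x₂ * x₁)) b⁻¹ := cb.inv_right
  have cg : Commute (b⁻¹ * (x₂ * x₁)) (b * b * b * b * b * (a * b⁻¹ * b⁻¹ * b⁻¹) * (b⁻¹ * b⁻¹ * b⁻¹ * b⁻¹ * b⁻¹)) :=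
    (((((cb.mul_right cb).mul_right cb).mul_right cb).mul_right cb).mul_right
      (((ca.mul_right cB).mul_right cB).mul_right cB)).mul_right ((((cB.mul_right cB).mul_right cB).mul_right cB).mul_right cB)
  have hx2' := SoloInformed_pair_uTrick cg hx2
  rw [SoloInformed_pair_g5_reduce (h2.trans h0.symm)] at hx2'
  -- transport along `a ↦ a' = b⁻¹ab` to the model of `SoloInformed_pairH_collapse_05`
  obtain ⟨a', ha'⟩ : ∃ a', a' = b⁻¹ * a * b := ⟨_, rfl⟩
  have ea : a = b * a' * b⁻¹ := by rw [ha']; simp [mul_assoc]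
  have h0' : a' * a' * a' = a' * b * a' * b := by
    calc a' * a' * a' = b⁻¹ * (a * a * a) * b := by rw [ha']; simp [mul_assoc]
    _ = b⁻¹ * (a * b * a * b) * b := by rw [h0]
    _ = a' * b * a' * b := by rw [ha']; simp [mul_assoc]
  have h2' : b * b * b * b * b * b * b = a' * b * a' * b := by
    calc b * b * b * b * b * b * b = b⁻¹ * (b * b * b * b * b * b * b) * b := by simp [mul_assoc]
    _ = b⁻¹ * (a * b * a * b) * b := by rw [h2]
    _ = a' * b * a' * b := by rw [ha']; simp [mul_assoc]
  have e1 : b * a' * b⁻¹ * b⁻¹ * b⁻¹ * b⁻¹ = a * b⁻¹ * b⁻¹ * b⁻¹ := by rw [ha']; simp [mul_assoc]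
  have e2 : b⁻¹ * a' * b⁻¹ * b⁻¹ = b⁻¹ * b⁻¹ * a * b⁻¹ := by rw [ha']; simp [mul_assoc]
  have e3 : a' * b⁻¹ * b⁻¹ * b⁻¹ = b * (b⁻¹ * b⁻¹ * a * b⁻¹) * b⁻¹ := by rw [ha']; simp [mul_assoc]
  have hx' : x₁ * (b * a' * b⁻¹ * b⁻¹ * b⁻¹ * b⁻¹) = b * a' * b⁻¹ * b⁻¹ * b⁻¹ * b⁻¹ * x₁ := by rw [e1]; exact hx1
  have hx2m : x₁ * (b⁻¹ * a' * b⁻¹ * b⁻¹) = a' * b⁻¹ * b⁻¹ * b⁻¹ * x₁ := by rw [e2, e3]; exact hx2'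
  obtain ⟨h1a, h1b⟩ := SoloInformed_pairH_collapse_05 h0' h2' hx' hx2m
  refine ⟨?_, h1b⟩
  rw [ea, h1a, h1b]; simp

/-- LEVEL ORDER `(g₅, g₀)`: in any group the relations of `G(b; g₅, g₀)` force `a = b = 1`. -/
theorem SoloInformed_pairG_collapse_50 (h0 : a * a * a = a * b * a * b) (h2 : b * b * b * b * b * b * b = a * b * a * b)
    (hca : x₂ * x₁ * a = b * a * b⁻¹ * (x₂ * x₁)) (hcb : x₂ * x₁ * b = b * (x₂ * x₁))
    (hx1 : x₁ * (b * b * b * b * b * (a * b⁻¹ * b⁻¹ * b⁻¹) * (b⁻¹ * b⁻¹ * b⁻¹ * b⁻¹ * b⁻¹))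
      = b * b * b * b * b * (a * b⁻¹ * b⁻¹ * b⁻¹) * (b⁻¹ * b⁻¹ * b⁻¹ * b⁻¹ * b⁻¹) * x₁)
    (hx2 : x₂ * (x₁ * (a * b⁻¹ * b⁻¹ * b⁻¹) * x₁⁻¹) = x₁ * (a * b⁻¹ * b⁻¹ * b⁻¹) * x₁⁻¹ * x₂) : a = 1 ∧ b = 1 := by
  obtain ⟨ca, cb⟩ := SoloInformed_pair_uComm hca hcb
  have cB : Commute (b⁻¹ * (x₂ * x₁)) b⁻¹ := cb.inv_right
  have cg : Commute (b⁻¹ * (x₂ * x₁)) (a * b⁻¹ * b⁻¹ * b⁻¹) := ((ca.mul_right cB).mul_right cB).mul_right cB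
  have hx2' := SoloInformed_pair_uTrick cg hx2
  have hz : b * b * b * b * b * b * b = a * a * a := h2.trans h0.symm
  rw [SoloInformed_pair_g5_reduce hz] at hx1
  -- transport along `a ↦ a' = b⁻³ab³` to the model of `SoloInformed_pairH_collapse_50`
  obtain ⟨a', ha'⟩ : ∃ a', a' = b⁻¹ * b⁻¹ * b⁻¹ * a * b * b * b := ⟨_, rfl⟩
  have ea : a = b * b * b * a' * b⁻¹ * b⁻¹ * b⁻¹ := by rw [ha']; simp [mul_assoc]
  have h0' : a' * a' * a' = a' * b * a' * b := by
    calc a' * a' * a' = b⁻¹ * b⁻¹ * b⁻¹ * (a * a * a) * b * b * b := by rw [ha']; simp [mul_assoc]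
    _ = b⁻¹ * b⁻¹ * b⁻¹ * (a * b * a * b) * b * b * b := by rw [h0]
    _ = a' * b * a' * b := by rw [ha']; simp [mul_assoc]
  have h2' : b * b * b * b * b * b * b = a' * b * a' * b := by
    calc b * b * b * b * b * b * b = b⁻¹ * b⁻¹ * b⁻¹ * (b * b * b * b * b * b * b) * b * b * b := by simp [mul_assoc]
    _ = b⁻¹ * b⁻¹ * b⁻¹ * (a * b * a * b) * b * b * b := by rw [h2]
    _ = a' * b * a' * b := by rw [ha']; simp [mul_assoc]
  have e1 : b * a' * b⁻¹ * b⁻¹ * b⁻¹ * b⁻¹ = b⁻¹ * b⁻¹ * a * b⁻¹ := by rw [ha']; simp [mul_assoc]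
  have e2 : b * b * b * a' * b⁻¹ * b⁻¹ * b⁻¹ * b⁻¹ * b⁻¹ * b⁻¹ = a * b⁻¹ * b⁻¹ * b⁻¹ := by rw [ha']; simp [mul_assoc]
  have e3 : b⁻¹ * b⁻¹ * b⁻¹ * a' = b * (a * b⁻¹ * b⁻¹ * b⁻¹) * b⁻¹ := by
    calc b⁻¹ * b⁻¹ * b⁻¹ * a' = b * (b * b * b * b * b * b * b)⁻¹ * a * b * b * b := by rw [ha']; simp [mul_assoc]
    _ = b * (a * a * a)⁻¹ * a * b * b * b := by rw [hz]
    _ = b * a * (a * a * a)⁻¹ * b * b * b := by simp [mul_assoc]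
    _ = b * a * (b * b * b * b * b * b * b)⁻¹ * b * b * b := by rw [hz]
    _ = _ := by simp [mul_assoc]
  have hx' : x₁ * (b * a' * b⁻¹ * b⁻¹ * b⁻¹ * b⁻¹) = b * a' * b⁻¹ * b⁻¹ * b⁻¹ * b⁻¹ * x₁ := by rw [e1]; exact hx1
  have hx2m : x₁ * (b * b * b * a' * b⁻¹ * b⁻¹ * b⁻¹ * b⁻¹ * b⁻¹ * b⁻¹) = b⁻¹ * b⁻¹ * b⁻¹ * a' * x₁ := by
    rw [e2, e3]; exact hx2'
  obtain ⟨h1a, h1b⟩ := SoloInformed_pairH_collapse_50 h0' h2' hx' hx2m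
  refine ⟨?_, h1b⟩
  rw [ea, h1a, h1b]; simp

end universal

/-! ### 2. The presented pair group: relations, the retraction to `F(x₁, x₂)`, freeness on the meridians -/

namespace SoloInformedPairGroup
open SoloInformedPGen
variable {φ g g' : FreeGroup SoloInformedPGen}

/-- The level meridian `x₁` of `G(φ; g, g')`. -/
def gx₁ : SoloInformedPairGroup φ g g' := PresentedGroup.of SoloInformedPGen.x₁
/-- The level meridian `x₂` of `G(φ; g, g')`. -/
def gx₂ : SoloInformedPairGroup φ g g' := PresentedGroup.of SoloInformedPGen.x₂
/-- The class of a word. -/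
abbrev cl (w : FreeGroup SoloInformedPGen) : SoloInformedPairGroup φ g g' := PresentedGroup.mk (pairRels φ g g') w

/-- `(x₂x₁) a = (φaφ⁻¹) (x₂x₁)` in `G(φ; g, g')`. -/
theorem r_conj_a : (gx₂ * gx₁ * ga : SoloInformedPairGroup φ g g') = cl φ * ga * (cl φ)⁻¹ * (gx₂ * gx₁) := by
  have h := rel_eq_one (φ := φ) (g := g) (g' := g') 2
  have e : pairRel φ g g' 2 = X₂ * X₁ * A * (X₂ * X₁)⁻¹ * (φ * A * φ⁻¹)⁻¹ := rfl
  rw [e, map_mul, map_inv, mul_inv_eq_one, map_mul, map_inv, mul_inv_eq_iff_eq_mul] at h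
  simpa [A, X₁, X₂, ga, gx₁, gx₂, PresentedGroup.of, map_mul, map_inv, mul_assoc] using h

/-- `(x₂x₁) b = (φbφ⁻¹) (x₂x₁)` in `G(φ; g, g')`. -/
theorem r_conj_b : (gx₂ * gx₁ * gb : SoloInformedPairGroup φ g g') = cl φ * gb * (cl φ)⁻¹ * (gx₂ * gx₁) := by
  have h := rel_eq_one (φ := φ) (g := g) (g' := g') 3
  have e : pairRel φ g g' 3 = X₂ * X₁ * B * (X₂ * X₁)⁻¹ * (φ * B * φ⁻¹)⁻¹ := rfl
  rw [e, map_mul, map_inv, mul_inv_eq_one, map_mul, map_inv, mul_inv_eq_iff_eq_mul] at h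
  simpa [B, X₁, X₂, gb, gx₁, gx₂, PresentedGroup.of, map_mul, map_inv, mul_assoc] using h

/-- `x₁ g = g x₁` in `G(φ; g, g')`. -/
theorem r_x1 : (gx₁ * cl g : SoloInformedPairGroup φ g g') = cl g * gx₁ := by
  have h := rel_eq_one (φ := φ) (g := g) (g' := g') 4
  have e : pairRel φ g g' 4 = X₁ * g * X₁⁻¹ * g⁻¹ := rfl
  rw [e, map_mul, map_inv, mul_inv_eq_one, map_mul, map_inv, mul_inv_eq_iff_eq_mul] at h
  simpa [X₁, gx₁, PresentedGroup.of, map_mul] using h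

/-- `x₂ (x₁g'x₁⁻¹) = (x₁g'x₁⁻¹) x₂` in `G(φ; g, g')`. -/
theorem r_x2 : (gx₂ * (gx₁ * cl g' * gx₁⁻¹) : SoloInformedPairGroup φ g g') = gx₁ * cl g' * gx₁⁻¹ * gx₂ := by
  have h := rel_eq_one (φ := φ) (g := g) (g' := g') 5
  have e : pairRel φ g g' 5 = X₂ * (X₁ * g' * X₁⁻¹) * X₂⁻¹ * (X₁ * g' * X₁⁻¹)⁻¹ := rfl
  rw [e, map_mul, map_inv, mul_inv_eq_one, map_mul, map_inv, mul_inv_eq_iff_eq_mul] at h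
  simpa [X₁, X₂, gx₁, gx₂, PresentedGroup.of, map_mul, map_inv, mul_assoc] using h

/-- The assignment killing the page group: `a, b ↦ 1`, `x₁ ↦ f`, `x₂ ↦ t` in `F(f, t) = FreeGroup Bool`. -/
def toFreeImg : SoloInformedPGen → FreeGroup Bool
  | .a => 1
  | .b => 1
  | .x₁ => FreeGroup.of false
  | .x₂ => FreeGroup.of true

/-- The relators die under the assignment, provided `g, g'` are page words (die themselves). -/
theorem lift_toFree_rel (hg : FreeGroup.lift toFreeImg g = 1) (hg' : FreeGroup.lift toFreeImg g' = 1) (k : Fin 6) :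
    FreeGroup.lift toFreeImg (pairRel φ g g' k) = 1 := by
  fin_cases k <;> simp [pairRel, A, B, X₁, X₂, toFreeImg, hg, hg']

/-- The retraction `G(φ; g, g') → F(x₁, x₂)` killing the page group. -/
def toFree (hg : FreeGroup.lift toFreeImg g = 1) (hg' : FreeGroup.lift toFreeImg g' = 1) :
    SoloInformedPairGroup φ g g' →* FreeGroup Bool :=
  PresentedGroup.toGroup (f := toFreeImg) (by rintro _ ⟨k, rfl⟩; exact lift_toFree_rel hg hg' k)

/-- The meridian map `F(x₁, x₂) → G(φ; g, g')`. -/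
def ofFree : FreeGroup Bool →* SoloInformedPairGroup φ g g' := FreeGroup.lift fun i => bif i then gx₂ else gx₁

/-- The retraction is a left inverse of the meridian map. -/
theorem toFree_comp_ofFree (hg : FreeGroup.lift toFreeImg g = 1) (hg' : FreeGroup.lift toFreeImg g' = 1) :
    (toFree (φ := φ) hg hg').comp ofFree = MonoidHom.id _ := by
  ext i; cases i <;> simp [toFree, ofFree, toFreeImg, gx₁, gx₂]

/-- If the page generators die, the meridian map is inverse to the retraction. -/
theorem ofFree_comp_toFree (hg : FreeGroup.lift toFreeImg g = 1) (hg' : FreeGroup.lift toFreeImg g' = 1)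
    (ha : (ga : SoloInformedPairGroup φ g g') = 1) (hb : (gb : SoloInformedPairGroup φ g g') = 1) :
    ofFree.comp (toFree (φ := φ) hg hg') = MonoidHom.id _ := by
  refine PresentedGroup.ext fun s => ?_
  cases s
  · simpa [toFree, toFreeImg, ga] using ha.symm
  · simpa [toFree, toFreeImg, gb] using hb.symm
  · simp [toFree, ofFree, toFreeImg, gx₁]
  · simp [toFree, ofFree, toFreeImg, gx₂]

/-- FREENESS CRITERION: if `a = b = 1` in `G(φ; g, g')` (page words `g, g'`), then `G(φ; g, g') ≃* F(x₁, x₂)`, the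
isomorphism being the retraction / the meridian map. -/
def mulEquivFree (hg : FreeGroup.lift toFreeImg g = 1) (hg' : FreeGroup.lift toFreeImg g' = 1)
    (ha : (ga : SoloInformedPairGroup φ g g') = 1) (hb : (gb : SoloInformedPairGroup φ g g') = 1) :
    SoloInformedPairGroup φ g g' ≃* FreeGroup Bool :=
  MonoidHom.toMulEquiv (toFree hg hg') ofFree (ofFree_comp_toFree hg hg' ha hb) (toFree_comp_ofFree hg hg')

/-- … in particular `G(φ; g, g')` is a free group. -/
theorem isFreeGroup_of_collapse (hg : FreeGroup.lift toFreeImg g = 1) (hg' : FreeGroup.lift toFreeImg g' = 1)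
    (ha : (ga : SoloInformedPairGroup φ g g') = 1) (hb : (gb : SoloInformedPairGroup φ g g') = 1) :
    IsFreeGroup (SoloInformedPairGroup φ g g') := IsFreeGroup.ofMulEquiv (mulEquivFree hg hg' ha hb).symm

end SoloInformedPairGroup

/-! ### 3. The banked pair `P*`: `φ = b`, classes `{g₀, g₅}`, both level orders -/

namespace SoloInformedPairPstar
open SoloInformedPGen SoloInformedPairGroup

/-- `φ = b` (the monodromy of `X(b) = (S⁴, τ⁷T(2,3))`). -/
def φw : FreeGroup SoloInformedPGen := B
/-- `g₀ = ab⁻³` (tunnel class). -/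
def g₀w : FreeGroup SoloInformedPGen := A * B⁻¹ * B⁻¹ * B⁻¹
/-- `g₅ = b⁵ g₀ b⁻⁵`. -/
def g₅w : FreeGroup SoloInformedPGen := B * B * B * B * B * (A * B⁻¹ * B⁻¹ * B⁻¹) * (B⁻¹ * B⁻¹ * B⁻¹ * B⁻¹ * B⁻¹)

/-- `g₀` is a page word (dies under the retraction). -/
theorem lift_g₀w : FreeGroup.lift toFreeImg g₀w = 1 := by simp [g₀w, A, B, toFreeImg]
/-- `g₅` is a page word (dies under the retraction). -/
theorem lift_g₅w : FreeGroup.lift toFreeImg g₅w = 1 := by simp [g₅w, A, B, toFreeImg]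

/-- `cl φw = b`. -/
theorem cl_φw {g g' : FreeGroup SoloInformedPGen} : (cl φw : SoloInformedPairGroup φw g g') = gb := rfl
/-- `cl g₀w = g₀ = ab⁻³`. -/
theorem cl_g₀w {φ g g' : FreeGroup SoloInformedPGen} : (cl g₀w : SoloInformedPairGroup φ g g') = ga * gb⁻¹ * gb⁻¹ * gb⁻¹ := rfl
/-- `cl g₅w = g₅ = b⁵g₀b⁻⁵`. -/
theorem cl_g₅w {φ g g' : FreeGroup SoloInformedPGen} : (cl g₅w : SoloInformedPairGroup φ g g')
    = gb * gb * gb * gb * gb * (ga * gb⁻¹ * gb⁻¹ * gb⁻¹) * (gb⁻¹ * gb⁻¹ * gb⁻¹ * gb⁻¹ * gb⁻¹) := rfl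

/-- In `G(b; g₀, g₅)` the page generators die: `a = 1` and `b = 1` (KERNEL form of the C604 entry "F", order `(g₀, g₅)`). -/
theorem collapse_05 : (ga : SoloInformedPairGroup φw g₀w g₅w) = 1 ∧ (gb : SoloInformedPairGroup φw g₀w g₅w) = 1 := by
  have hca := r_conj_a (φ := φw) (g := g₀w) (g' := g₅w)
  have hcb := r_conj_b (φ := φw) (g := g₀w) (g' := g₅w)
  have hx1 := r_x1 (φ := φw) (g := g₀w) (g' := g₅w)
  have hx2 := r_x2 (φ := φw) (g := g₀w) (g' := g₅w)
  rw [cl_φw] at hca hcb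
  rw [cl_g₀w] at hx1
  rw [cl_g₅w] at hx2
  rw [mul_inv_cancel_right] at hcb
  exact SoloInformed_pairG_collapse_05 r0 r2 hca hcb hx1 hx2

/-- In `G(b; g₅, g₀)` the page generators die (order `(g₅, g₀)`). -/
theorem collapse_50 : (ga : SoloInformedPairGroup φw g₅w g₀w) = 1 ∧ (gb : SoloInformedPairGroup φw g₅w g₀w) = 1 := by
  have hca := r_conj_a (φ := φw) (g := g₅w) (g' := g₀w)
  have hcb := r_conj_b (φ := φw) (g := g₅w) (g' := g₀w)
  have hx1 := r_x1 (φ := φw) (g := g₅w) (g' := g₀w)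
  have hx2 := r_x2 (φ := φw) (g := g₅w) (g' := g₀w)
  rw [cl_φw] at hca hcb
  rw [cl_g₅w] at hx1
  rw [cl_g₀w] at hx2
  rw [mul_inv_cancel_right] at hcb
  exact SoloInformed_pairG_collapse_50 r0 r2 hca hcb hx1 hx2

/-- THE LINK GROUP OF `P*` IS FREE ON THE MERIDIANS (order `(g₀, g₅)`): `G(b; g₀, g₅) ≃* F(x₁, x₂)`. -/
def mulEquivFree_05 : SoloInformedPairGroup φw g₀w g₅w ≃* FreeGroup Bool :=
  mulEquivFree lift_g₀w lift_g₅w collapse_05.1 collapse_05.2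

/-- `G(b; g₀, g₅)` is a free group. -/
theorem isFreeGroup_05 : IsFreeGroup (SoloInformedPairGroup φw g₀w g₅w) :=
  isFreeGroup_of_collapse lift_g₀w lift_g₅w collapse_05.1 collapse_05.2

/-- Order `(g₅, g₀)`: `G(b; g₅, g₀) ≃* F(x₁, x₂)`. -/
def mulEquivFree_50 : SoloInformedPairGroup φw g₅w g₀w ≃* FreeGroup Bool :=
  mulEquivFree lift_g₅w lift_g₀w collapse_50.1 collapse_50.2

/-- `G(b; g₅, g₀)` is a free group. -/
theorem isFreeGroup_50 : IsFreeGroup (SoloInformedPairGroup φw g₅w g₀w) :=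
  isFreeGroup_of_collapse lift_g₅w lift_g₀w collapse_50.1 collapse_50.2

/-- CONTRAST (the dichotomy of C604 inside Lean): the antipodal pair group `G(b; g₀, g₃)` is not free
(`SoloInformedPairB.not_isFreeGroup`) while `G(b; g₀, g₅)` is. -/
theorem dichotomy : IsFreeGroup (SoloInformedPairGroup φw g₀w g₅w)
    ∧ ¬ IsFreeGroup (SoloInformedPairGroup SoloInformedPairB.φw SoloInformedPairB.gw SoloInformedPairB.g'w) :=
  ⟨isFreeGroup_05, SoloInformedPairB.not_isFreeGroup⟩

end SoloInformedPairPstar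

end Summit.SmoothPoincare4.SmoothPoincare4.Theorems
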